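import Summits.KontsevichZagierPeriods.KontsevichZagierPeriods.Theorems.LinRedNormalFormArrangementNormalFormSeparateTwoMonoSplitGlue
import Summits.KontsevichZagierPeriods.KontsevichZagierPeriods.Theorems.LinRedNormalFormArrangementNormalFormSeparateTwoLocMass
import Summits.KontsevichZagierPeriods.KontsevichZagierPeriods.Theorems.LinRedNormalFormArrangementNormalFormSeparateTwoMass

/-!
# Termwise convergence at a point: the three abstract outputs of the monomial split

(Line `janus-bands`, crux `ArrangementNormalForm`, stub `stub_separateTwoPos_hI`, part `HIOrder`.)
The termwise absolute convergence of the Taylor split (`separatePos_split`, hypothesis `hI`) is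
proved locally at every point of the closed base piece, on thin sectors in blown-up coordinates
`(x, v)`, against a measurable weight `W` that is almost decreasing towards the corner
(`separateTwo_corner`). This file packages the three ways in which the monomial split
(`SepTwo.monoSplit'`) is consumed there:
* `SepTwo.monomial_lt_top` — every monomial `x^i v^j` with a NON-ZERO coefficient of an
  absolutely `W`-integrable polynomial is `W`-integrable (the pieces at the pole direction and at
  the letter direction are sums of such monomials);
* `SepTwo.order_lt_top` (registered as `separateTwo_hiOrder`) — if moreover `W` moves towards the
  direction `v → 0` at a logarithmic cost (`separateTwo_cornerLog`), then `x^i` itself is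
  `W`-integrable (`separateTwo_angular`): the pieces at the other directions through a point of
  the pole line are `O(x^i)` for the order `i` of the numerator;
* `SepTwo.mass_lt_top` — with logarithmic costs in both variables (`separateTwo_radialLog`),
  `W` itself is integrable (`separateTwo_locMass`): the pieces at points off the pole line are
  bounded.
Also: separation / bound constants of finitely many reals (the constants `G, g, R` of
`separateTwo_corner`) and the measurability of the fibre mass as a function of the base point.
-/

noncomputable section

open Set MeasureTheory
open scoped ENNReal

namespace Summit.KontsevichZagierPeriods.ArrangementNormalForm.JanusBands

namespace SepTwo

/-! ### Constants -/

/-- **Separation constant.** Distinct values of `f` on a finite set are `G`-separated for some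
`G > 0`. -/
theorem exists_sep_const {ι : Type*} (U : Finset ι) (f : ι → ℝ) :
    ∃ G : ℝ, 0 < G ∧ ∀ c ∈ U, ∀ c' ∈ U, f c ≠ f c' → G ≤ |f c - f c'| := by
  classical
  set S := ((U ×ˢ U).image fun cc : ι × ι => |f cc.1 - f cc.2|).filter (fun r => 0 < r) with hS
  have hmem : ∀ c ∈ U, ∀ c' ∈ U, f c ≠ f c' → |f c - f c'| ∈ S := fun c hc c' hc' hcc =>
    Finset.mem_filter.2 ⟨Finset.mem_image.2 ⟨(c, c'), Finset.mem_product.2 ⟨hc, hc'⟩, rfl⟩,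
      abs_pos.2 (sub_ne_zero.2 hcc)⟩
  by_cases hne : S.Nonempty
  · refine ⟨S.min' hne, (Finset.mem_filter.1 (S.min'_mem hne)).2, fun c hc c' hc' hcc => ?_⟩
    exact S.min'_le _ (hmem c hc c' hc' hcc)
  · exact ⟨1, one_pos, fun c hc c' hc' hcc => absurd ⟨_, hmem c hc c' hc' hcc⟩ hne⟩

/-- **Bound constant.** Two real functions on a finite set are bounded by some `R > 0`. -/
theorem exists_bound_const {ι : Type*} (U : Finset ι) (p q : ι → ℝ) :
    ∃ R : ℝ, 0 < R ∧ (∀ c ∈ U, |p c| ≤ R) ∧ ∀ c ∈ U, |q c| ≤ R := by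
  refine ⟨1 + ∑ c ∈ U, (|p c| + |q c|), by positivity, fun c hc => ?_, fun c hc => ?_⟩
  · have h := Finset.single_le_sum (f := fun c => |p c| + |q c|) (fun c _ => by positivity) hc
    linarith [abs_nonneg (q c)]
  · have h := Finset.single_le_sum (f := fun c => |p c| + |q c|) (fun c _ => by positivity) hc
    linarith [abs_nonneg (p c)]

/-! ### Measurability of the fibre mass in the base point -/

/-- The fibre mass `lmass lo hi a (av x)` is a measurable function of the base point `x`. -/
theorem measurable_lmass_av {B k : ℕ} (lo hi : Fin k → Fin k ⊕ Atm B) (a : Fin k → Option (Atm B)) :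
    Measurable fun x : Fin B → ℝ => lmass lo hi a (av x) := by
  set E := {p : (Fin B → ℝ) × (Fin k → ℝ) | p.1 ∈ (univ : Set (Fin B → ℝ)) ∧ p.2 ∈ cell lo hi (av p.1)}
    with hE
  have hEm : MeasurableSet E := measurableSet_pdom MeasurableSet.univ lo hi
  have hGm : Measurable fun p : (Fin B → ℝ) × (Fin k → ℝ) => lblock a (av p.1) p.2 :=
    measurable_lblock_prod a
  have h := (hGm.indicator hEm).lintegral_prod_right' (ν := (volume : Measure (Fin k → ℝ)))
  refine (funext fun x => ?_ : (fun x : Fin B → ℝ => ∫⁻ t, E.indicator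
    (fun p : (Fin B → ℝ) × (Fin k → ℝ) => lblock a (av p.1) p.2) (x, t)) =
    fun x => lmass lo hi a (av x)) ▸ h
  unfold lmass
  rw [← lintegral_indicator (measurableSet_cell lo hi _)]
  refine lintegral_congr fun t => ?_
  by_cases ht : t ∈ cell lo hi (av x)
  · rw [indicator_of_mem (show (x, t) ∈ E from ⟨mem_univ _, ht⟩), indicator_of_mem ht]
  · rw [indicator_of_notMem (show (x, t) ∉ E from fun h => ht h.2), indicator_of_notMem ht]

/-! ### The three outputs of the monomial split -/

/-- **Monomials with a non-zero coefficient are integrable.** -/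
theorem monomial_lt_top (d : ℕ) (c : Fin (d + 1) → Fin (d + 1) → ℝ) (W : ℝ → ℝ → ℝ≥0∞)
    (hW : Measurable (Function.uncurry W)) (K : ℝ≥0∞) (hK : K ≠ ∞) (δ ε : ℝ)
    (hmono : ∀ x v x' v', 0 < x → x ≤ x' → x' ≤ 4 * x → x' < 4 * δ → 0 < v → v ≤ v' →
      v' ≤ 4 * v → v' < 4 * ε → W x v ≤ K * W x' v')
    (hfin : ∫⁻ x in Ioo 0 (4 * δ), ∫⁻ v in Ioo 0 (4 * ε),
      ENNReal.ofReal |∑ i', ∑ j', c i' j' * x ^ (i' : ℕ) * v ^ (j' : ℕ)| * W x v < ∞)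
    (i j : Fin (d + 1)) (hc : c i j ≠ 0) :
    ∫⁻ x in Ioo 0 δ, ∫⁻ v in Ioo 0 ε, ENNReal.ofReal (x ^ (i : ℕ) * v ^ (j : ℕ)) * W x v < ∞ := by
  have h := monoSplit' d c W hW K hK δ ε hmono hfin i j
  have heq : ∫⁻ x in Ioo 0 δ, ∫⁻ v in Ioo 0 ε,
      ENNReal.ofReal (|c i j| * x ^ (i : ℕ) * v ^ (j : ℕ)) * W x v =
      ENNReal.ofReal |c i j| *
        ∫⁻ x in Ioo 0 δ, ∫⁻ v in Ioo 0 ε, ENNReal.ofReal (x ^ (i : ℕ) * v ^ (j : ℕ)) * W x v := by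
    rw [← lintegral_const_mul' _ _ ENNReal.ofReal_ne_top]
    refine lintegral_congr fun x => ?_
    rw [← lintegral_const_mul' _ _ ENNReal.ofReal_ne_top]
    refine lintegral_congr fun v => ?_
    rw [← mul_assoc, ← ENNReal.ofReal_mul (abs_nonneg _), mul_assoc]
  rw [heq] at h
  rcases ENNReal.mul_lt_top_iff.1 h with ⟨-, hb⟩ | h0 | h0
  · exact hb
  · exact absurd h0 (by simpa using hc)
  · rw [h0]; exact ENNReal.zero_lt_top

/-- **The order output.** An almost-decreasing weight with a logarithmic angular cost integrates
`x^i` as soon as it integrates a polynomial with some coefficient `c i j ≠ 0`. -/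
theorem order_lt_top (d : ℕ) (c : Fin (d + 1) → Fin (d + 1) → ℝ) (W : ℝ → ℝ → ℝ≥0∞)
    (hW : Measurable (Function.uncurry W)) (K : ℝ≥0∞) (hK : K ≠ ∞) (δ ε : ℝ) (hε : 0 < ε)
    (hmono : ∀ x v x' v', 0 < x → x ≤ x' → x' ≤ 4 * x → x' < 4 * δ → 0 < v → v ≤ v' →
      v' ≤ 4 * v → v' < 4 * ε → W x v ≤ K * W x' v')
    (Kn : ℕ) (C : ℝ≥0∞) (hC : C ≠ ∞)
    (hang : ∀ x, 0 < x → x < δ → ∀ v v', 0 < v → v ≤ v' → v' < ε →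
      W x v ≤ C * ENNReal.ofReal ((1 + Real.log (v' / v)) ^ Kn) * W x v')
    (hfin : ∫⁻ x in Ioo 0 (4 * δ), ∫⁻ v in Ioo 0 (4 * ε),
      ENNReal.ofReal |∑ i', ∑ j', c i' j' * x ^ (i' : ℕ) * v ^ (j' : ℕ)| * W x v < ∞)
    (i j : Fin (d + 1)) (hc : c i j ≠ 0) :
    ∫⁻ x in Ioo 0 δ, ∫⁻ v in Ioo 0 ε, ENNReal.ofReal (x ^ (i : ℕ)) * W x v < ∞ := by
  have h1 := monomial_lt_top d c W hW K hK δ ε hmono hfin i j hc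
  set A : ℝ≥0∞ := (C * ENNReal.ofReal (4 * (1 + 2 * Kn) ^ Kn) + 1) * ENNReal.ofReal ((2 / ε) ^ (j : ℕ))
    with hA
  have hAne : A ≠ ∞ := ENNReal.mul_ne_top (ENNReal.add_ne_top.2
    ⟨ENNReal.mul_ne_top hC ENNReal.ofReal_ne_top, ENNReal.one_ne_top⟩) ENNReal.ofReal_ne_top
  have h2 : ∀ x ∈ Ioo (0 : ℝ) δ, ∫⁻ v in Ioo 0 ε, W x v ≤
      A * ∫⁻ v in Ioo 0 ε, ENNReal.ofReal (v ^ (j : ℕ)) * W x v := fun x hx =>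
    lintegral_le_pow_of_logmono (W x) hW.of_uncurry_left Kn C hε
      (fun v v' hv hvv' hv' => hang x hx.1 hx.2 v v' hv hvv' hv') j
  have hmx : ∀ x : ℝ, Measurable fun v => ENNReal.ofReal (v ^ (j : ℕ)) * W x v := fun x =>
    (ENNReal.measurable_ofReal.comp (measurable_id.pow_const _)).mul hW.of_uncurry_left
  calc ∫⁻ x in Ioo 0 δ, ∫⁻ v in Ioo 0 ε, ENNReal.ofReal (x ^ (i : ℕ)) * W x v
      = ∫⁻ x in Ioo 0 δ, ENNReal.ofReal (x ^ (i : ℕ)) * ∫⁻ v in Ioo 0 ε, W x v :=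
        lintegral_congr fun x => lintegral_const_mul _ hW.of_uncurry_left
    _ ≤ ∫⁻ x in Ioo 0 δ, ENNReal.ofReal (x ^ (i : ℕ)) *
          (A * ∫⁻ v in Ioo 0 ε, ENNReal.ofReal (v ^ (j : ℕ)) * W x v) :=
        setLIntegral_mono' measurableSet_Ioo fun x hx => mul_le_mul_right (h2 x hx) _
    _ = A * ∫⁻ x in Ioo 0 δ, ∫⁻ v in Ioo 0 ε, ENNReal.ofReal (x ^ (i : ℕ) * v ^ (j : ℕ)) * W x v := by
        rw [← lintegral_const_mul' A _ hAne]
        refine setLIntegral_congr_fun measurableSet_Ioo fun x hx => ?_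
        rw [mul_left_comm, ← lintegral_const_mul _ (hmx x)]
        congr 1
        refine lintegral_congr fun v => ?_
        rw [ENNReal.ofReal_mul (pow_nonneg hx.1.le _), mul_assoc]
    _ < ∞ := ENNReal.mul_lt_top hAne.lt_top h1

/-- **The mass output.** An almost-decreasing weight with logarithmic costs in both variables is
integrable as soon as it integrates a polynomial with some non-zero coefficient. -/
theorem mass_lt_top (d : ℕ) (c : Fin (d + 1) → Fin (d + 1) → ℝ) (W : ℝ → ℝ → ℝ≥0∞)
    (hW : Measurable (Function.uncurry W)) (K : ℝ≥0∞) (hK : K ≠ ∞) (δ ε : ℝ) (hδ : 0 < δ)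
    (hε : 0 < ε)
    (hmono : ∀ x v x' v', 0 < x → x ≤ x' → x' ≤ 4 * x → x' < 4 * δ → 0 < v → v ≤ v' →
      v' ≤ 4 * v → v' < 4 * ε → W x v ≤ K * W x' v')
    (Kn : ℕ) (C : ℝ≥0∞) (hC : C ≠ ∞)
    (hrad : ∀ v, 0 < v → v < ε → ∀ x x', 0 < x → x ≤ x' → x' < δ →
      W x v ≤ C * ENNReal.ofReal ((1 + Real.log (x' / x)) ^ Kn) * W x' v)
    (hang : ∀ x, 0 < x → x < δ → ∀ v v', 0 < v → v ≤ v' → v' < ε →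
      W x v ≤ C * ENNReal.ofReal ((1 + Real.log (v' / v)) ^ Kn) * W x v')
    (hfin : ∫⁻ x in Ioo 0 (4 * δ), ∫⁻ v in Ioo 0 (4 * ε),
      ENNReal.ofReal |∑ i', ∑ j', c i' j' * x ^ (i' : ℕ) * v ^ (j' : ℕ)| * W x v < ∞)
    (i j : Fin (d + 1)) (hc : c i j ≠ 0) :
    ∫⁻ x in Ioo 0 δ, ∫⁻ v in Ioo 0 ε, W x v < ∞ :=
  lintegral_lt_top_of_logmono₂ W hW Kn C hC hδ hε hrad hang i j
    (monomial_lt_top d c W hW K hK δ ε hmono hfin i j hc)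

end SepTwo

/-- **The order output of the monomial split** (registered part of `stub_separateTwoPos_hI`;
literal form of `SepTwo.order_lt_top`): a measurable weight on `(0, 4δ) × (0, 4ε)`, almost
decreasing towards the corner at scale `4` and with a logarithmic angular cost on
`(0, δ) × (0, ε)`, which integrates the polynomial `∑ c i' j' x^{i'} v^{j'}` absolutely,
integrates `x^i` on `(0, δ) × (0, ε)` for every row `i` carrying a non-zero coefficient
`c i j`. -/
theorem separateTwo_hiOrder (d : ℕ) (c : Fin (d + 1) → Fin (d + 1) → ℝ) (W : ℝ → ℝ → ENNReal) (hW : Measurable (Function.uncurry W)) (K : ENNReal) (hK : K ≠ ⊤) (δ ε : ℝ) (hε : 0 < ε) (hmono : ∀ x v x' v' : ℝ, 0 < x → x ≤ x' → x' ≤ 4 * x → x' < 4 * δ → 0 < v → v ≤ v' → v' ≤ 4 * v → v' < 4 * ε → W x v ≤ K * W x' v') (Kn : ℕ) (C : ENNReal) (hC : C ≠ ⊤) (hang : ∀ x : ℝ, 0 < x → x < δ → ∀ v v' : ℝ, 0 < v → v ≤ v' → v' < ε → W x v ≤ C * ENNReal.ofReal ((1 + Real.log (v' / v)) ^ Kn)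 * W x v') (hfin : MeasureTheory.lintegral (MeasureTheory.volume.restrict (Set.Ioo 0 (4 * δ))) (fun x => MeasureTheory.lintegral (MeasureTheory.volume.restrict (Set.Ioo 0 (4 * ε))) (fun v => ENNReal.ofReal |∑ i' : Fin (d + 1), ∑ j' : Fin (d + 1), c i' j' * x ^ (i' : ℕ) * v ^ (j' : ℕ)| * W x v)) < ⊤) (i j : Fin (d + 1)) (hc : c i j ≠ 0) : MeasureTheory.lintegral (MeasureTheory.volume.restrict (Set.Ioo 0 δ)) (fun x => MeasureTheory.lintegral (MeasureTheory.volume.restrict (Set.Ioo 0 ε)) (fun v => ENNReal.ofReal (x ^ (i : ℕ)) * W x v)) < ⊤ := by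
  exact SepTwo.order_lt_top d c W hW K hK δ ε hε hmono Kn C hC hang hfin i j hc

end Summit.KontsevichZagierPeriods.ArrangementNormalForm.JanusBands
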